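import Mathlib
import Literature.MathematicalPhysics.QuantumFieldTheory.Luscher2010.TrivializingMaps
import Literature.MathematicalPhysics.QuantumFieldTheory.Luscher2010.FlowActionSeries
import Summits.Ventures.LatticeQCDFlow.TrivializingMaps.Truncation
import Summits.Ventures.LatticeQCDFlow.TrivializingMaps.TruncationDefect
import Summits.Ventures.LatticeQCDFlow.TrivializingMaps.SeriesUniqueness
import Summits.Ventures.LatticeQCDFlow.TrivializingMaps.GaugeCovariance
import Summits.Ventures.LatticeQCDFlow.TrivializingMaps.WilsonPolynomials
import Summits.Ventures.LatticeQCDFlow.TrivializingMaps.LuscherSeriesExistence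
import Summits.Ventures.LatticeQCDFlow.TrivializingMaps.ExtensiveDefectReduction
import Summits.Ventures.LatticeQCDFlow.TrivializingMaps.BasisIndependence
import Summits.Ventures.LatticeQCDFlow.TrivializingMaps.GradientControl
import Summits.Ventures.LatticeQCDFlow.TrivializingMaps.SeriesGradientBound
import HarnessLib

/-!
# Reductions of the geometric gradient bound (Theorem A) to the anchored recursion in one fixed basis

HONEST FRAMING: exact (Metropolis-corrected) sampling algorithms for lattice gauge theory; figures of merit are
autocorrelation/cost numbers at stated couplings and volumes; no continuum-physics claim.

Venture `LatticeQCDFlow` (cell pub-lqcd), topic `TrivializingMaps`, FANOUT row 28 (theory-1), route R-T1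
(Lüscher's perturbative trivializing maps; typed targets of `Truncation.lean`).  The cell's one open analytic
statement is `LuscherGeometricGradientBound d n` (`Truncation.lean` §6, `@[conjecture]`): a volume-uniform
geometric bound `|∂^a_e S̃^{(k)}(ιU)| ≤ C ρ^{-k}` for EVERY lattice size `L`, EVERY orthonormal basis `B` of `𝔰𝔲(n)`
and EVERY smooth solution `(S̃^{(k)})_k` of Lüscher's recursion for the Wilson plaquette action.  This file does
not prove it; it shrinks what has to be proved (theorems only, nothing is asserted about the conjecture):

* `IsLuscherSeries.of_suBasis` — Lüscher's recursion does not depend on the basis: a smooth series solving it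
  for `B` solves it for `B'` (`Δ` and `𝓥_S` are basis-free, `BasisIndependence.lean`);
* `luscherGeometricGradientBound_iff_wilsonSk` — by uniqueness of gradients (`SeriesUniqueness.lean`) the
  conjecture is equivalent to the same bound for the ONE constructed series `wilsonSk d L B`
  (`LuscherSeriesExistence.lean`) — the quantifier over all smooth solutions is spurious;
* `luscherGeometricGradientBound_iff_fixedBasis` — it is moreover equivalent to the bound for ONE fixed basis
  `B₀` (directions `T_a ∈ B₀` only, series `wilsonSk d L B₀` only): coordinates of unit vectors are bounded
  (`exists_coord_bound`) and `∂_{e,Y}` is linear in `Y`;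
* `LuscherAnchoredGeometricBound d n B₀` (`@[conjecture]`, a venture obligation like Theorem A itself, NOT a
  Literature fact and NOT asserted): the anchored terms `G^{(k)}_{e₀} = anchTerm B₀ k e₀` of the constructed series
  (ONE finite-dimensional linear recursion per anchor link, of the same shape in every volume:
  `G^{(k)}_{e₀} ∈ PD(4(k+1), linkBall (k+1) e₀)`) obey `|∂_{e,T_a} G^{(k)}_{e₀}(ιU)| ≤ C ρ^{-k}` for all
  `L, k, e₀, e, a, U`; `luscherAnchoredGeometricBound_iff_unit` — equivalently for all unit directions `Y ∈ 𝔰𝔲(n)`;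
* `luscherGeometricGradientBound_of_anchored` — **reduction to the anchored recursion**: the anchored bound for
  one basis implies Theorem A, with radius `ρ/(1+16d²)` and constant `(1+16d²)·max C 0` — the only volume
  dependence, the number of anchors whose ball contains a given link, is `≤ (1+16d²)^{k+1}` (`abs_sum_anchor_le`)
  and is absorbed into the rate.

So the cell's Theorem A — and with it the log-depth law `LogDepthWilsonFlowSampler.lean` — follows from a
statement about a single explicitly constructed sequence of local link polynomials in a fixed basis; this is the
form (per-anchor / per-link norms) in which the U(1) analogue IS kernel-checked in the tree
(`Abelian.abelianGeometricGradientBound`, `AbelianGeometricBound.lean`: `N_e(a^{(k)}) ≤ (D/4)(3D)^k`) and in which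
§12-type majorant estimates for `SU(n)` would be carried out.  Nothing here asserts either conjecture.
[cite: Luscher2010Trivializing, §4.3 eqs. (4.11)–(4.15), §4.5(b), App. A.1, App. E]
-/

namespace Summit.Ventures.LatticeQCDFlow.TrivializingMaps

open Literature.MathematicalPhysics.QuantumFieldTheory
open Literature.MathematicalPhysics.QuantumFieldTheory.Luscher2010
open scoped Matrix Matrix.Norms.Frobenius ContDiff

/-! ## §1. The recursion is basis-free -/

section Basis

variable {d L n : ℕ} [NeZero L]

/-- **Lüscher's recursion does not depend on the basis.** If a smooth series `(S̃^{(k)})_k` solves the recursion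
(4.13)–(4.15) for a differentiable action `S` written in the orthonormal basis `B` of `𝔰𝔲(n)`, it solves it in any
other orthonormal basis `B'` (with the same constants): `Δ` and `∑_{e,a} ∂^a_e S ∂^a_e f` are basis-free.
[cite: Luscher2010Trivializing, §4.3 eqs. (4.13)–(4.15), App. A.1 (after eq. (A.2))] -/
theorem IsLuscherSeries.of_suBasis (B B' : SuBasis n) {S : AmbConfig d L n → ℝ} (hS : Differentiable ℝ S)
    {Sk : ℕ → AmbConfig d L n → ℝ} {c : ℕ → ℝ} (hsm : ∀ k, ContDiff ℝ ∞ (Sk k))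
    (h : IsLuscherSeries B S Sk c) : IsLuscherSeries B' S Sk c := by
  refine ⟨fun U => ?_, fun k U => ?_⟩
  · rw [← linkLap_suBasis_eq B B' (hsm 0)]
    exact h.1 U
  · rw [← linkLap_suBasis_eq B B' (hsm (k + 1)), h.2 k U]
    congr 2
    exact Finset.sum_congr rfl fun e _ =>
      sum_linkDeriv_mul_suBasis_eq B B' (hS _) ((hsm k).differentiable (by simp) _) e

end Basis

/-! ## §2. Theorem A for the constructed series, in one basis; reduction to the anchored recursion -/

section Reduction

/-- **Theorem A is a statement about the constructed series.** The geometric gradient bound for ALL smooth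
solutions of Lüscher's recursion is equivalent to the same bound for the one constructed solution
`S̃_W^{(k)} = wilsonSk d L B k` (all smooth solutions have the same gradients on `SU(n)^E`).
[cite: Luscher2010Trivializing, §4.3, §4.5(b)] -/
theorem luscherGeometricGradientBound_iff_wilsonSk (d n : ℕ) :
    LuscherGeometricGradientBound d n ↔
      ∃ ρ : ℝ, 0 < ρ ∧ ∃ C : ℝ, ∀ (L : ℕ) [NeZero L] (B : SuBasis n) (k : ℕ)
        (U : GaugeConfig d L (Matrix.specialUnitaryGroup (Fin n) ℂ)) (e : Edge d L) (a : B.ι),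
        |linkDeriv e (B.T a) (wilsonSk d L B k) (WilsonFlow.coeConfig U)| ≤ C * ρ⁻¹ ^ k := by
  constructor
  · rintro ⟨ρ, hρ, C, hC⟩
    exact ⟨ρ, hρ, C, fun L _ B k U e a => hC L B (wilsonSk d L B) (wilsonConst d L B)
      (contDiff_wilsonSk B) (isLuscherSeries_wilsonSk B) k U e a⟩
  · rintro ⟨ρ, hρ, C, hC⟩
    refine ⟨ρ, hρ, C, fun L _ B Sk c hsm hser k U e a => ?_⟩
    rw [(IsLuscherSeries.linkDeriv_eq hser (isLuscherSeries_wilsonSk B) hsm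
      (fun j => contDiff_wilsonSk B j) k).2 e a U]
    exact hC L B k U e a

/-- **Theorem A in one fixed basis.** For any fixed orthonormal basis `B₀` of `𝔰𝔲(n)`, the geometric gradient
bound is equivalent to: `∃ ρ > 0, C` with `|∂_{e,T_a} S̃_W^{(k)}[B₀](ιU)| ≤ C ρ^{-k}` for all `L, k, U, e` and all
`T_a ∈ B₀` — one series, one set of directions.  (A series for `B` is a series for `B₀`; its `B₀`-gradients
are those of `wilsonSk d L B₀`; a generator `T'_b` of another basis has `B₀`-coordinates bounded by
`exists_coord_bound`, and `∂_{e,Y}` is linear in `Y`.)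
[cite: Luscher2010Trivializing, §4.3, §4.5(b), App. A.3 eq. (A.10)] -/
theorem luscherGeometricGradientBound_iff_fixedBasis (d n : ℕ) (B₀ : SuBasis n) :
    LuscherGeometricGradientBound d n ↔
      ∃ ρ : ℝ, 0 < ρ ∧ ∃ C : ℝ, ∀ (L : ℕ) [NeZero L] (k : ℕ)
        (U : GaugeConfig d L (Matrix.specialUnitaryGroup (Fin n) ℂ)) (e : Edge d L) (a : B₀.ι),
        |linkDeriv e (B₀.T a) (wilsonSk d L B₀ k) (WilsonFlow.coeConfig U)| ≤ C * ρ⁻¹ ^ k := by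
  constructor
  · rintro ⟨ρ, hρ, C, hC⟩
    exact ⟨ρ, hρ, C, fun L _ k U e a => hC L B₀ (wilsonSk d L B₀) (wilsonConst d L B₀)
      (contDiff_wilsonSk B₀) (isLuscherSeries_wilsonSk B₀) k U e a⟩
  · rintro ⟨ρ, hρ, C, hC⟩
    choose D hD0 hD using fun a : B₀.ι => exists_coord_bound B₀ a
    refine ⟨ρ, hρ, (∑ a, D a) * max C 0, fun L _ B Sk c hsm hser k U e b => ?_⟩
    have hser₀ : IsLuscherSeries B₀ ambWilsonAction Sk c :=
      IsLuscherSeries.of_suBasis B B₀ (contDiff_ambWilsonAction.differentiable (by simp)) hsm hser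
    have hdir : ∀ a : B₀.ι,
        |linkDeriv e (B₀.T a) (Sk k) (WilsonFlow.coeConfig U)| ≤ max C 0 * ρ⁻¹ ^ k := fun a => by
      rw [(IsLuscherSeries.linkDeriv_eq hser₀ (isLuscherSeries_wilsonSk B₀) hsm
        (fun j => contDiff_wilsonSk B₀ j) k).2 e a U]
      exact (hC L k U e a).trans (by gcongr; exact le_max_left _ _)
    have hexp : linkDeriv e (B.T b) (Sk k) (WilsonFlow.coeConfig U) =
        ∑ a, B₀.coord a (B.T b) * linkDeriv e (B₀.T a) (Sk k) (WilsonFlow.coeConfig U) := by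
      conv_lhs => rw [← sum_coord_smul_eq B₀ (B.mem b)]
      exact linkDeriv_sum_smul ((hsm k).differentiable (by simp) _) e _ _
    rw [hexp]
    calc |∑ a, B₀.coord a (B.T b) * linkDeriv e (B₀.T a) (Sk k) (WilsonFlow.coeConfig U)|
        ≤ ∑ a, |B₀.coord a (B.T b) * linkDeriv e (B₀.T a) (Sk k) (WilsonFlow.coeConfig U)| :=
          Finset.abs_sum_le_sum_abs _ _
      _ ≤ ∑ a, D a * (max C 0 * ρ⁻¹ ^ k) := Finset.sum_le_sum fun a _ => by
          rw [abs_mul]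
          exact mul_le_mul (hD a _ (suBasis_norm_le_one B b)) (hdir a) (abs_nonneg _) (hD0 a)
      _ = (∑ a, D a) * max C 0 * ρ⁻¹ ^ k := by rw [← Finset.sum_mul]; ring

/-- **The anchored geometric bound** (CONJECTURE; a venture obligation stronger than Theorem A, reducing it to
one explicit recursion — see `luscherGeometricGradientBound_of_anchored`).  For the fixed orthonormal basis `B₀` of
`𝔰𝔲(n)`: there are `ρ > 0` and `C` such that the anchored terms `G^{(k)}_{e₀} = anchTerm B₀ k e₀` of the
constructed Lüscher series of the Wilson action (`S̃_W^{(k)} = ∑_{e₀} G^{(k)}_{e₀}`; `G^{(k+1)}_{e₀}` is obtained from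
`G^{(k)}_{e₀}` by ONE finite-dimensional linear map — multiply by the gradients of the `≤ 4d²` plaquettes through the
ball, project, invert `Δ` on `PD(4(k+2), linkBall (k+2) e₀)` — of the same shape in every volume) satisfy
`|∂_{e,T_a} G^{(k)}_{e₀}(ιU)| ≤ C ρ^{-k}` for every lattice size `L`, order `k`, anchor `e₀`, link `e`, generator
`T_a ∈ B₀` and `U ∈ SU(n)^E`.  Its U(1) analogue (per-link norm `N_e(a^{(k)}) ≤ (D/4)(3D)^k` on every plaquette
complex of girth 4) is the tree's `Abelian.abelianGeometricGradientBound`; for `SU(n)` it is OPEN here (Lüscher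
proves nothing about the rate; §4.5(b) reports `ρ > 1` compatible with the computed orders).
[cite: Luscher2010Trivializing, §4.3 eqs. (4.13)–(4.15), §4.5(b)] -/
@[conjecture]
def LuscherAnchoredGeometricBound (d n : ℕ) (B₀ : SuBasis n) : Prop :=
  ∃ ρ : ℝ, 0 < ρ ∧ ∃ C : ℝ, ∀ (L : ℕ) [NeZero L] (k : ℕ) (e₀ e : Edge d L)
    (U : GaugeConfig d L (Matrix.specialUnitaryGroup (Fin n) ℂ)) (a : B₀.ι),
    |linkDeriv e (B₀.T a) (anchTerm B₀ k e₀) (WilsonFlow.coeConfig U)| ≤ C * ρ⁻¹ ^ k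

/-- The anchored bound along the generators `T_a ∈ B₀` is equivalent to the anchored bound along all unit
directions `Y ∈ 𝔰𝔲(n)` (`‖T_a‖ ≤ 1`; conversely `Y = ∑_a Y^a T_a` with `|Y^a| ≤ D_a` on the unit ball and `∂_{e,Y}`
linear in `Y`). [cite: Luscher2010Trivializing, App. A.3 eq. (A.10)] -/
theorem luscherAnchoredGeometricBound_iff_unit (d n : ℕ) (B₀ : SuBasis n) :
    LuscherAnchoredGeometricBound d n B₀ ↔
      ∃ ρ : ℝ, 0 < ρ ∧ ∃ C : ℝ, ∀ (L : ℕ) [NeZero L] (k : ℕ) (e₀ e : Edge d L) (Y : Matrix (Fin n) (Fin n) ℂ),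
        Y ∈ suAlgebra n → ‖Y‖ ≤ 1 → ∀ U : GaugeConfig d L (Matrix.specialUnitaryGroup (Fin n) ℂ),
        |linkDeriv e Y (anchTerm B₀ k e₀) (WilsonFlow.coeConfig U)| ≤ C * ρ⁻¹ ^ k := by
  constructor
  · rintro ⟨ρ, hρ, C, hC⟩
    choose D hD0 hD using fun a : B₀.ι => exists_coord_bound B₀ a
    refine ⟨ρ, hρ, (∑ a, D a) * max C 0, fun L _ k e₀ e Y hY hY1 U => ?_⟩
    have hexp : linkDeriv e Y (anchTerm B₀ k e₀) (WilsonFlow.coeConfig U) =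
        ∑ a, B₀.coord a Y * linkDeriv e (B₀.T a) (anchTerm B₀ k e₀) (WilsonFlow.coeConfig U) := by
      conv_lhs => rw [← sum_coord_smul_eq B₀ hY]
      exact linkDeriv_sum_smul ((contDiff_anchTerm B₀ k e₀).differentiable (by simp) _) e _ _
    rw [hexp]
    calc |∑ a, B₀.coord a Y * linkDeriv e (B₀.T a) (anchTerm B₀ k e₀) (WilsonFlow.coeConfig U)|
        ≤ ∑ a, |B₀.coord a Y * linkDeriv e (B₀.T a) (anchTerm B₀ k e₀) (WilsonFlow.coeConfig U)| :=
          Finset.abs_sum_le_sum_abs _ _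
      _ ≤ ∑ a, D a * (max C 0 * ρ⁻¹ ^ k) := Finset.sum_le_sum fun a _ => by
          rw [abs_mul]
          exact mul_le_mul (hD a Y hY1) ((hC L k e₀ e U a).trans (by gcongr; exact le_max_left _ _))
            (abs_nonneg _) (hD0 a)
      _ = (∑ a, D a) * max C 0 * ρ⁻¹ ^ k := by rw [← Finset.sum_mul]; ring
  · rintro ⟨ρ, hρ, C, hC⟩
    exact ⟨ρ, hρ, C, fun L _ k e₀ e U a => hC L k e₀ e (B₀.T a) (B₀.mem a) (suBasis_norm_le_one B₀ a) U⟩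

/-- **Reduction of Theorem A to the anchored recursion.** The anchored geometric bound for ONE orthonormal
basis `B₀` implies the geometric gradient bound (Theorem A), with radius `ρ/(1+16d²)` and constant
`(1+16d²)·max C 0`: `∂_{e,T_a} S̃_W^{(k)} = ∑_{e₀} ∂_{e,T_a} G^{(k)}_{e₀}`, only anchors with `e ∈ linkBall (k+1) e₀`
contribute, a link lies in at most `(1+16d²)^{k+1}` such balls (`abs_sum_anchor_le`), and this volume-independent
count is absorbed into the rate; then `luscherGeometricGradientBound_iff_fixedBasis`.
[cite: Luscher2010Trivializing, §4.3 eqs. (4.13)–(4.15), §4.5(b)] -/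
theorem luscherGeometricGradientBound_of_anchored {d n : ℕ} (B₀ : SuBasis n)
    (h : LuscherAnchoredGeometricBound d n B₀) : LuscherGeometricGradientBound d n := by
  obtain ⟨ρ, hρ, C, hA⟩ := h
  refine (luscherGeometricGradientBound_iff_fixedBasis d n B₀).2
    ⟨ρ / (1 + 16 * (d * d)), by positivity, (1 + 16 * (d * d)) * max C 0, fun L _ k U e a => ?_⟩
  have hD : linkDeriv e (B₀.T a) (wilsonSk d L B₀ k) (WilsonFlow.coeConfig U) =
      ∑ e₀ : Edge d L, linkDeriv e (B₀.T a) (anchTerm B₀ k e₀) (WilsonFlow.coeConfig U) := by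
    have h := linkDeriv_finset_sum e (B₀.T a) Finset.univ (fun e₀ : Edge d L => anchTerm B₀ k e₀)
      (fun e₀ _ => contDiff_anchTerm B₀ k e₀)
    rw [show wilsonSk d L B₀ k = fun W => ∑ e₀ : Edge d L, anchTerm B₀ k e₀ W from rfl]
    exact congrFun h (WilsonFlow.coeConfig U)
  rw [hD]
  have hK0 : 0 ≤ max C 0 * ρ⁻¹ ^ k := by positivity
  refine (abs_sum_anchor_le (k + 1) e _ hK0 (fun e₀ he₀ => ?_) (fun e₀ => ?_)).trans_eq ?_
  · rw [linkDeriv_eq_zero_of_not_mem (B₀.T a) (Submodule.mem_inf.1 (anchTerm_mem B₀ k e₀)).2 he₀]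
  · exact (hA L k e₀ e U a).trans (by gcongr; exact le_max_left _ _)
  · rw [inv_div, div_eq_mul_inv, mul_pow]
    ring

end Reduction

end Summit.Ventures.LatticeQCDFlow.TrivializingMaps
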